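import Summits.PneNP.PneNP.Theses.OneSlice
import Literature.Computability.Complexity.CircuitLowerBoundsProofs
import Literature.Computability.Complexity.Rossman2008CliqueProofs

/-!
# `ConstantBand` (stmt-PneNP-2834, route PneNP/OneSlice, rung #3) — negative-side lemmas: load-bearing hypotheses

Standing-adversary (cdisprove) output for the crux `Summit.PneNP.PneNP.Theses.OneSlice.ConstantBand`:
`∀ c, ∃ k ≥ 3, ∃ w, ∃ δ > 0, ∀ᶠ n, ∀ j` central (`|j - m_k(n)| ≤ m_k(n)^{3/4}`, `m_k(n) = ⌊C(n,2)·n^{-2/(k-1)}⌋₊`),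
`∀ C` over `{∧₂, ∨₂}`: `Σ_{i ∈ [j-w, j+w]} #{x : e(x) = i, C(x) ≠ CLIQUE_k(x)} / #{x : e(x) = i} ≤ δ ⟹ n^c < |C|`.
The crux is NOT refuted and NOT mis-stated; this file records, as theorems, what any proof must use:

* §0 `constantBand_iff` (`Iff.rfl` bridge: inline clique function = `cliqueFn`, inline edge count = `edgeCount`;
  schedule form `BandLB c k w δ`), `not_bandLB_iff` / `not_constantBand_iff` (what a kill must deliver),
  `BandLB.mono_width` / `anti_delta` / `anti_exp` (wider band, smaller δ, smaller exponent = weaker claim),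
  `constantBand_iff_eventually_width`, `bandErr_eq_zero_of_eval`.
* §1 `constantBand_false_without_basis` — the basis restriction is load-bearing: one unbounded fan-in gate computes
  CLIQUE_k exactly (size 1, band error 0), so the basis-free variant fails at `c = 0`.
* §2 `constantBand_false_without_central` — the centrality window is load-bearing: at the top edge count
  `j = C(n,2)` the OR of all edges (≤ C(n,2) ≤ n² gates) is EXACT on the band once `n ≥ k + 2w`
  (`cliqueFn_eq_true_of_card_false_le`: ≤ t missing edges and `k + 2t ≤ n` leave a k-clique); fails at `c = 3`.

Companions: `ExponentVsK.lean` (the witness `k` must grow with `c`), `DeltaFloor.lean` (`δ ≤ (2w+1)/k!` is forced).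
Refuter seat cdisprove-stmt-PneNP-2834 (gen 1), 2026-08-16.
-/

set_option linter.dupNamespace false

namespace Summit.PneNP.PneNP.Theorems.ConstantBand.Negative

open Literature.Computability.Complexity Filter Finset Classical
open Summit.PneNP.PneNP.Theses.OneSlice (ConstantBand)

/-- The edge-variable type of `K_n`. [folklore] -/
abbrev Edge (n : ℕ) : Type := ((⊤ : SimpleGraph (Fin n)).edgeSet)

/-! ## §0 Vocabulary, bridge and monotonicity -/

/-- The `k`-clique threshold edge count `m_k(n) = ⌊C(n,2) · n^{-2/(k-1)}⌋₊` of the crux. [folklore] -/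
noncomputable def thr (k n : ℕ) : ℕ :=
  ⌊((n.choose 2 : ℕ) : ℝ) * (n : ℝ) ^ (-(2 : ℝ) / ((k : ℝ) - 1))⌋₊

/-- Centrality of an edge count `j`: `|j - m_k(n)| ≤ m_k(n)^{3/4}`. [folklore] -/
def Central (k n j : ℕ) : Prop :=
  |(j : ℝ) - (thr k n : ℝ)| ≤ (thr k n : ℝ) ^ ((3 : ℝ) / 4)

/-- The threshold itself is central. [folklore] -/
theorem central_thr (k n : ℕ) : Central k n (thr k n) := by
  simp only [Central, sub_self, abs_zero]
  exact Real.rpow_nonneg (Nat.cast_nonneg _) _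

/-- The Hamming slice of edge count `i`. [folklore] -/
noncomputable def slice (n i : ℕ) : Finset (Edge n → Bool) :=
  univ.filter fun x => edgeCount x = i

/-- The error set of `C` against `CLIQUE_k` on the slice `i`. [folklore] -/
noncomputable def errSet (n k i : ℕ) (C : Circuit (Edge n)) : Finset (Edge n → Bool) :=
  univ.filter fun x => edgeCount x = i ∧ C.eval x ≠ cliqueFn n k x

/-- The band error: the sum over `i ∈ [j-w, j+w]` of the error fractions on the slices. [folklore] -/
noncomputable def bandErr (n k j w : ℕ) (C : Circuit (Edge n)) : ℝ :=
  ∑ i ∈ Icc (j - w) (j + w), (#(errSet n k i C) : ℝ) / (#(slice n i) : ℝ)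

/-- The crux at fixed parameters: eventually in `n`, every monotone circuit that is `δ`-accurate on the
band of width `w` around a central `j` has more than `n^c` gates. [folklore] -/
def BandLB (c k w : ℕ) (δ : ℝ) : Prop :=
  ∀ᶠ n : ℕ in atTop, ∀ j : ℕ, Central k n j → ∀ C : Circuit (Edge n), C.IsOver monotoneBasis →
    bandErr n k j w C ≤ δ → n ^ c < C.size

/-- **Bridge.** The crux is `∀ c, ∃ k ≥ 3, ∃ w, ∃ δ > 0, BandLB c k w δ` — definitionally: the inline
clique function is `cliqueFn`, the inline edge count is `edgeCount`. [folklore] -/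
theorem constantBand_iff :
    ConstantBand ↔ ∀ c : ℕ, ∃ k : ℕ, 3 ≤ k ∧ ∃ w : ℕ, ∃ δ : ℝ, 0 < δ ∧ BandLB c k w δ :=
  Iff.rfl

/-- Negation of the schedule form. [folklore] -/
theorem not_bandLB_iff {c k w : ℕ} {δ : ℝ} :
    ¬ BandLB c k w δ ↔ ∃ᶠ n : ℕ in atTop, ∃ j : ℕ, Central k n j ∧ ∃ C : Circuit (Edge n),
      C.IsOver monotoneBasis ∧ bandErr n k j w C ≤ δ ∧ C.size ≤ n ^ c := by
  rw [BandLB, not_eventually]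
  constructor
  · intro h
    refine h.mono fun n hn => ?_
    by_contra hcon
    apply hn
    intro j hj C hC herr
    by_contra hlt
    exact hcon ⟨j, hj, C, hC, herr, not_lt.1 hlt⟩
  · intro h
    refine h.mono fun n hn hall => ?_
    obtain ⟨j, hj, C, hC, herr, hs⟩ := hn
    exact absurd (hall j hj C hC herr) (not_lt.2 hs)

/-- **What a kill must deliver**: one exponent `c` and, for EVERY `k ≥ 3`, `w`, `δ > 0`, infinitely many
`n` with a monotone circuit of size `≤ n^c` that is `δ`-accurate on a band around a central `j`. [folklore] -/
theorem not_constantBand_iff :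
    ¬ ConstantBand ↔ ∃ c : ℕ, ∀ k : ℕ, 3 ≤ k → ∀ w : ℕ, ∀ δ : ℝ, 0 < δ →
      ∃ᶠ n : ℕ in atTop, ∃ j : ℕ, Central k n j ∧ ∃ C : Circuit (Edge n), C.IsOver monotoneBasis ∧
        bandErr n k j w C ≤ δ ∧ C.size ≤ n ^ c := by
  rw [constantBand_iff]
  push Not
  simp only [not_bandLB_iff]

/-- Band errors are nonnegative. [folklore] -/
theorem bandErr_nonneg (n k j w : ℕ) (C : Circuit (Edge n)) : 0 ≤ bandErr n k j w C :=
  sum_nonneg fun _ _ => div_nonneg (Nat.cast_nonneg _) (Nat.cast_nonneg _)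

/-- The band error grows with the width. [folklore] -/
theorem bandErr_mono_width {n k j w w' : ℕ} (h : w ≤ w') (C : Circuit (Edge n)) :
    bandErr n k j w C ≤ bandErr n k j w' C := by
  apply sum_le_sum_of_subset_of_nonneg
  · intro i hi
    simp only [mem_Icc] at hi ⊢
    omega
  · intro i _ _
    exact div_nonneg (Nat.cast_nonneg _) (Nat.cast_nonneg _)

/-- Wider band = weaker claim: `BandLB` is monotone in `w`. [folklore] -/
theorem BandLB.mono_width {c k w w' : ℕ} {δ : ℝ} (h : w ≤ w') (H : BandLB c k w δ) :
    BandLB c k w' δ := by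
  filter_upwards [H] with n hn j hj C hC herr
  exact hn j hj C hC ((bandErr_mono_width h C).trans herr)

/-- Smaller `δ` = weaker claim: `BandLB` is antitone in `δ`. [folklore] -/
theorem BandLB.anti_delta {c k w : ℕ} {δ δ' : ℝ} (h : δ' ≤ δ) (H : BandLB c k w δ) :
    BandLB c k w δ' := by
  filter_upwards [H] with n hn j hj C hC herr
  exact hn j hj C hC (herr.trans h)

/-- Smaller exponent = weaker claim: `BandLB` is antitone in `c`. [folklore] -/
theorem BandLB.anti_exp {c c' k w : ℕ} {δ : ℝ} (h : c' ≤ c) (H : BandLB c k w δ) :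
    BandLB c' k w δ := by
  filter_upwards [H, eventually_ge_atTop 1] with n hn h1 j hj C hC herr
  exact lt_of_le_of_lt (Nat.pow_le_pow_right h1 h) (hn j hj C hC herr)

/-- `∃ w` may be read "for all large `w`". [folklore] -/
theorem constantBand_iff_eventually_width :
    ConstantBand ↔ ∀ c : ℕ, ∃ k : ℕ, 3 ≤ k ∧ ∃ δ : ℝ, 0 < δ ∧ ∀ᶠ w : ℕ in atTop, BandLB c k w δ := by
  rw [constantBand_iff]
  refine forall_congr' fun c => exists_congr fun k => and_congr_right fun _ => ?_
  constructor
  · rintro ⟨w, δ, hδ, H⟩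
    exact ⟨δ, hδ, eventually_atTop.2 ⟨w, fun w' hw' => H.mono_width hw'⟩⟩
  · rintro ⟨δ, hδ, H⟩
    obtain ⟨w, hw⟩ := H.exists
    exact ⟨w, δ, hδ, hw⟩

/-- A circuit that agrees with `CLIQUE_k` everywhere has band error `0`. [folklore] -/
theorem bandErr_eq_zero_of_eval {n k j w : ℕ} {C : Circuit (Edge n)}
    (h : ∀ x, edgeCount x ∈ Icc (j - w) (j + w) → C.eval x = cliqueFn n k x) :
    bandErr n k j w C = 0 := by
  apply sum_eq_zero
  intro i hi
  have : errSet n k i C = ∅ := by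
    refine filter_eq_empty_iff.2 fun x _ hx => hx.2 (h x ?_)
    rw [hx.1]
    exact hi
  simp [this]

/-! ## §1 The basis restriction `C.IsOver monotoneBasis` is load-bearing -/

/-- One unbounded fan-in gate (truth table = `CLIQUE_k`) computes `CLIQUE_k` with a single gate. [folklore] -/
theorem exists_oneGate_cliqueFn (n k : ℕ) :
    ∃ C : Circuit (Edge n), C.size ≤ 1 ∧ ∀ x, C.eval x = cliqueFn n k x := by
  let N := Fintype.card (Edge n)
  let eqv : Edge n ≃ Fin N := Fintype.equivFin _
  let g : GateFn := ⟨N, fun v => cliqueFn n k fun e => v (eqv e)⟩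
  obtain ⟨C, -, hs, he⟩ :=
    (CktSize.gate (B := Set.univ) g (Set.mem_univ _) fun a => eqv.symm a).toCircuit
  refine ⟨C, hs, fun x => ?_⟩
  rw [he x]
  show cliqueFn n k (fun e => x (eqv.symm (eqv e))) = _
  simp

/-- **The basis restriction is load-bearing**: the crux with the hypothesis `C.IsOver monotoneBasis` dropped
(arbitrary gates of arbitrary fan-in; everything else as filed) fails at `c = 0`. [folklore] -/
theorem constantBand_false_without_basis :
    ¬ ∀ c : ℕ, ∃ k : ℕ, 3 ≤ k ∧ ∃ w : ℕ, ∃ δ : ℝ, 0 < δ ∧ ∀ᶠ n : ℕ in atTop, ∀ j : ℕ, Central k n j →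
      ∀ C : Circuit (Edge n), bandErr n k j w C ≤ δ → n ^ c < C.size := by
  intro h
  obtain ⟨k, -, w, δ, hδ, hev⟩ := h 0
  obtain ⟨n, hn⟩ := hev.exists
  obtain ⟨C, hs, he⟩ := exists_oneGate_cliqueFn n k
  have hlt := hn (thr k n) (central_thr k n) C
    (by rw [bandErr_eq_zero_of_eval fun x _ => he x]; exact hδ.le)
  simp only [pow_zero] at hlt
  omega

/-! ## §2 The centrality window is load-bearing (top end: `j = C(n,2)`) -/

/-- An unordered pair has at most two members. [folklore] -/
theorem card_filter_mem_sym2_le {n : ℕ} (e : Sym2 (Fin n)) :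
    #(univ.filter fun v : Fin n => v ∈ e) ≤ 2 := by
  induction e using Sym2.ind with
  | h a b =>
    calc #(univ.filter fun v : Fin n => v ∈ s(a, b)) ≤ #({a, b} : Finset (Fin n)) := by
          apply card_le_card
          intro v hv
          simp only [mem_filter, mem_univ, true_and, Sym2.mem_iff] at hv
          rcases hv with rfl | rfl <;> simp
      _ ≤ 2 := card_le_two

/-- **Few missing edges leave a clique.** If at most `t` edges of `K_n` are off in `x` and `k + 2t ≤ n`,
then the graph of `x` contains a `k`-clique (delete both endpoints of every missing edge). [folklore] -/
theorem cliqueFn_eq_true_of_card_false_le {n k t : ℕ} (x : Edge n → Bool)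
    (ht : #(univ.filter fun e : Edge n => x e = false) ≤ t) (hn : k + 2 * t ≤ n) :
    cliqueFn n k x = true := by
  rw [cliqueFn_eq_true_iff]
  set M : Finset (Edge n) := univ.filter fun e : Edge n => x e = false with hM
  set B : Finset (Fin n) := M.biUnion fun e => univ.filter fun v : Fin n => v ∈ (e : Sym2 (Fin n))
    with hB
  have hBcard : #B ≤ 2 * t := by
    calc #B ≤ ∑ e ∈ M, #(univ.filter fun v : Fin n => v ∈ (e : Sym2 (Fin n))) := card_biUnion_le
      _ ≤ ∑ _e ∈ M, 2 := sum_le_sum fun e _ => card_filter_mem_sym2_le (e : Sym2 (Fin n))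
      _ = 2 * #M := by rw [sum_const, smul_eq_mul, mul_comm]
      _ ≤ 2 * t := by omega
  -- the complement of `B` is a clique
  have hclique : (cliqueGraph x).IsClique ((Bᶜ : Finset (Fin n)) : Set (Fin n)) := by
    intro u hu v hv huv
    rw [cliqueGraph_adj]
    refine ⟨huv, ?_⟩
    by_contra hx
    have hmem : (⟨s(u, v), by simpa using huv⟩ : Edge n) ∈ M :=
      mem_filter.2 ⟨mem_univ _, by simpa using hx⟩
    have huB : u ∈ B :=
      mem_biUnion.2 ⟨_, hmem, mem_filter.2 ⟨mem_univ _, Sym2.mem_mk_left u v⟩⟩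
    exact (mem_compl.1 (mem_coe.1 hu)) huB
  have hcard : k ≤ #(Bᶜ) := by
    rw [card_compl, Fintype.card_fin]
    omega
  obtain ⟨T, hT, hTk⟩ := exists_subset_card_eq hcard
  intro hfree
  exact hfree T ⟨hclique.subset (by exact_mod_cast hT), hTk⟩

/-- `a ≤ C(n,2)` once `a ≤ n` and `n ≥ 3`. [folklore] -/
theorem le_choose_two {a n : ℕ} (ha : a ≤ n) (hn : 3 ≤ n) : a ≤ n.choose 2 := by
  rw [Nat.choose_two_right]
  apply (Nat.le_div_iff_mul_le (by norm_num)).2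
  exact Nat.mul_le_mul ha (by omega)

/-- The OR of all edges: a monotone circuit of size `≤ C(n,2)` that is `1` iff some edge is on. [folklore] -/
theorem exists_orAll (n : ℕ) (hn : 2 ≤ n) :
    ∃ C : Circuit (Edge n), C.IsOver monotoneBasis ∧ C.size ≤ n.choose 2 ∧
      ∀ x, C.eval x = true ↔ ∃ e, x e = true := by
  have hne : (univ : Finset (Edge n)).toList ≠ [] := by
    intro hnil
    have h0 : Fintype.card (Edge n) = 0 := by
      rw [← card_univ, ← Finset.length_toList, hnil, List.length_nil]
    rw [card_edgeSet_top_fin] at h0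
    have : 0 < n.choose 2 := Nat.choose_pos hn
    omega
  obtain ⟨C, hCB, hs, he⟩ := (cktSize_any (univ : Finset (Edge n)).toList hne).toCircuit
  refine ⟨C, hCB, ?_, fun x => ?_⟩
  · rwa [Finset.length_toList, card_univ, card_edgeSet_top_fin] at hs
  · rw [he x, List.any_eq_true]
    simp

/-- **The centrality window is load-bearing**: without it the crux fails at `c = 3` — at the top edge
count `j = C(n,2)` the OR of all edges is exact on the whole band `[C(n,2) - w, C(n,2) + w]` once
`n ≥ k + 2w`, and has `≤ C(n,2) ≤ n² < n³` gates (the crux with the centrality hypothesis dropped, everything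
else as filed, is false). [folklore] -/
theorem constantBand_false_without_central :
    ¬ ∀ c : ℕ, ∃ k : ℕ, 3 ≤ k ∧ ∃ w : ℕ, ∃ δ : ℝ, 0 < δ ∧ ∀ᶠ n : ℕ in atTop, ∀ j : ℕ,
      ∀ C : Circuit (Edge n), C.IsOver monotoneBasis → bandErr n k j w C ≤ δ → n ^ c < C.size := by
  intro h
  obtain ⟨k, hk, w, δ, hδ, hev⟩ := h 3
  obtain ⟨n, hn, hnk⟩ := (hev.and (eventually_ge_atTop (k + 2 * w + 2))).exists
  obtain ⟨C, hCB, hs, he⟩ := exists_orAll n (by omega)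
  have hN : Fintype.card (Edge n) = n.choose 2 := card_edgeSet_top_fin n
  -- on the band around the top slice the OR of all edges is exact
  have hexact : ∀ x : Edge n → Bool, edgeCount x ∈ Icc (n.choose 2 - w) (n.choose 2 + w) →
      C.eval x = cliqueFn n k x := by
    intro x hx
    rw [mem_Icc] at hx
    have hwN : w + 1 ≤ n.choose 2 := le_choose_two (by omega) (by omega)
    have hfalse : #(univ.filter fun e : Edge n => x e = false) ≤ w := by
      have h := card_filter_eq_false x
      have h' : (univ.filter fun e : Edge n => ¬ x e = true) = univ.filter fun e : Edge n => x e = false := by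
        congr 1; ext e; simp
      rw [h'] at h
      rw [h]
      omega
    have h1 : cliqueFn n k x = true := cliqueFn_eq_true_of_card_false_le x hfalse (by omega)
    have h2 : C.eval x = true := by
      rw [he x]
      by_contra hno
      push Not at hno
      have : edgeCount x = 0 := by
        rw [edgeCount, card_eq_zero, filter_eq_empty_iff]
        intro e _
        simpa using hno e
      omega
    rw [h1, h2]
  have hlt := hn (n.choose 2) C hCB (by rw [bandErr_eq_zero_of_eval hexact]; exact hδ.le)
  have h2 : n.choose 2 ≤ n ^ 2 := Nat.choose_le_pow n 2
  have h3 : n ^ 2 < n ^ 3 := Nat.pow_lt_pow_right (by omega) (by norm_num)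
  omega

end Summit.PneNP.PneNP.Theorems.ConstantBand.Negative
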